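import Literature.NumberTheory.GelbartRogawski1991.LocalUnitaryBlockRestriction
import Literature.RepresentationTheory.MoeglinVignerasWaldspurger1987.RankOneThetaLiftNonvanishingProofs
import Literature.RepresentationTheory.TwistedCoinvariantsTensor
import HarnessLib

-- buildfix G11b-3 recipe (as in the GelbartRogawski1991 siblings): sequential elaboration.
set_option Elab.async false

/-!
# The `U(L)`-types of a rank-one theta lift: `Θ_s(χ)|_{U(V₁)}` has the types of `ω_{V₁}` when `V₂` is isotropic

Topic `RepresentationTheory/MoeglinVignerasWaldspurger1987`; namespace
`Literature.RepresentationTheory.MoeglinVignerasWaldspurger1987`.  KERNEL only (one auxiliary definition with body — the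
shear automorphism of `U(V₁) × Z` — and theorems; no named fact, no `sorry`).

Setting (the block currency of `GelbartRogawski1991/LocalUnitaryBlockRestriction`): `T = T₁ ⊕ᶠ T₂` with `Tᵢ` symmetric,
`det Tᵢ` units, sizes `n₁ + n₂`, `J = T ⊗ 1`, a finite place `v` with `E ⊗_F F_v` a field, a homomorphism
`s : U(J)(F_v) →* S̃p(𝕎_v)` over `ι_v` with `ω_s` smooth, the centre `Z = U(J′)(F_v) = E_v¹` (`localCenter`), a unitary
continuous character `χ` of `Z`, and `Θ_s(χ)` = the `χ`-coinvariants of `ω_s` under `Z` with their `U(J)(F_v)`-action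
(`TwistedCoinv.rep`).  Restrict `Θ_s(χ)` to the first block `U(J₁)(F_v)` (`BlockSum.inlLoc`).

* §1 `centreShear` — the automorphism `(u, z) ↦ (u · z·1_{n₁}, z)` of `U(J₁)(F_v) × Z`; the pair representation
  `(u, z) ↦ ω_s(u ⊕ 1) ω_s(z · 1)` is the pull-back along it of `(u′, z) ↦ ω_s((u′ ⊕ 1)(1 ⊕ z·1_{n₂}))`
  (`pairRep_eq_comp_centreShear`, from `BlockSum.localCenter_eq_inlLoc_mul_inrLoc`);
* §2 the latter is the outer tensor product `ω_{s₁} ⊠ (ω_{s₂} ∘ centre)` transported along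
  `𝒮(F_v^{n₁}) ⊗ 𝒮(F_v^{n₂}) ≃ 𝒮(F_v^{n₁+n₂})` (`BlockSum.toRep_inlLoc_mul_inrLoc_boxSB`), so by
  `TwistedCoinv.coinvCoinvEquiv` / `coinvCompEquiv` / `mapEquiv` / `coinvTensorEquiv`:
  **`Coinv_ξ(Θ_s(χ)|U(J₁)) ≃ Coinv_ξ(ω_{s₁}) ⊗ Θ^{V₂}_{s₂}(χ · (ξ ∘ centre₁)⁻¹)`** (`coinvLineEquiv`);
* §3 **`nontrivial_coinv_line_iff`** — if `(E_v^{n₂}, J₂)` is ISOTROPIC (`2 ≤ n₂`), then for every unitary continuous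
  `ξ : U(J₁)(F_v) → ℂˣ`: `Coinv_ξ(Θ_s(χ)|U(J₁)) ≠ 0 ↔ Coinv_ξ(ω_{s₁}) ≠ 0` — the second tensor factor is non-zero by the
  PROVED fact IV-2 `mvw_IV2_rankOne_nonvanishing_of_isotropic_holds` (stable range), so the `U(J₁)`-TYPE SET of `Θ_s(χ)`
  is that of the small oscillator representation `ω_{s₁}`, independently of `χ`.

This is the structural input of route R for row IV-4c3 (`rankOne_theta_twist_rigidity`): with `n₁ = 1` (an anisotropic
line `L`, `n₂ = 2`, `H = L^⊥` hyperbolic at `v`) the type set of `Θ_s(χ)|_{U(L)}` is the dichotomy set of the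
`(U(1), U(1))` oscillator representation `ω_{s_L}`.  HC_CM is NOT proved here and is proved only modulo the printed
citations until rung 0 closes.

## References
* [MoeglinVignerasWaldspurger1987] LNM 1291 (1987), Chap. 2 II.1 Rem. (6) (restriction to `U(V₁) × U(V₂)`), Chap. 3 IV.2
  (stable range).
* [Kudla1984] S. Kudla, *Seesaw dual reductive pairs*, Progr. Math. 46 (1984), §1.
-/

set_option autoImplicit false

noncomputable section

open NumberField IsDedekindDomain
open scoped TensorProduct Matrix
open Literature.RepresentationTheory.HeisenbergGroup (MpPsi)
open Literature.RepresentationTheory.TwistedCoinv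
open Literature.NumberTheory.GelbartRogawski1991.UnitaryDualPair.LocalSplitting
open Literature.NumberTheory.GelbartRogawski1991.UnitaryDualPair.LocalSplitting.BlockSum
open Literature.NumberTheory.Automorphic
open Literature.NumberTheory.Automorphic.Liu2021

namespace Literature.RepresentationTheory.MoeglinVignerasWaldspurger1987

variable (F : Type) [Field F] [NumberField F] (E : Type) [Field E] [NumberField E] [Algebra F E]
  [Algebra.IsQuadraticExtension F E] (c : E ≃ₐ[F] E) {δ : E} (hcδ : c δ = -δ) (hδ : δ ≠ 0) {d : F}
  (hd : δ * δ = algebraMap F E d) (v : HeightOneSpectrum (𝓞 F)) (n₁ n₂ : ℕ)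
  {T₁ : Matrix (Fin n₁) (Fin n₁) F} {T₂ : Matrix (Fin n₂) (Fin n₂) F} (hT₁ : T₁.IsSymm) (hT₂ : T₂.IsSymm)
  (hT₁d : IsUnit T₁.det) (hT₂d : IsUnit T₂.det)
  {J₁ : Matrix (Fin n₁) (Fin n₁) E} (hJ₁ : J₁ = T₁.map (algebraMap F E))
  {J₂ : Matrix (Fin n₂) (Fin n₂) E} (hJ₂ : J₂ = T₂.map (algebraMap F E))
  {J : Matrix (Fin (n₁ + n₂)) (Fin (n₁ + n₂)) E} (hJ : J = (UnitaryGroup.finSum n₁ n₂ T₁ T₂).map (algebraMap F E))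
  (s : UnitaryGroup.localPi E c (n₁ + n₂) J v →* LocalMp F (n₁ + n₂) (UnitaryGroup.finSum n₁ n₂ T₁ T₂) v)
  (hs : ∀ g, MpPsi.proj _ (s g) =
    iota F E c (n₁ + n₂) hcδ hδ hd (UnitaryGroup.finSum n₁ n₂ T₁ T₂) (UnitaryGroup.isSymm_finSum hT₁ hT₂) hJ v g)
  {J' : Matrix (Fin 1) (Fin 1) E} (hJ' : J' 0 0 ≠ 0)

set_option quotPrecheck false in
local notation "Fv" => v.adicCompletion F
set_option quotPrecheck false in
local notation "eS" => (finSumFinEquiv : Fin n₁ ⊕ Fin n₂ ≃ Fin (n₁ + n₂))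
set_option quotPrecheck false in
/-- the group of the first block. -/
local notation "G₁" => UnitaryGroup.localPi E c n₁ J₁ v
set_option quotPrecheck false in
/-- the centre line group. -/
local notation "Zc" => UnitaryGroup.localPi E c 1 J' v
set_option quotPrecheck false in
/-- `ω_s` on `𝒮(F_v^{n₁+n₂})`. -/
local notation "ω" => MonoidHom.comp (MpPsi.toRep (localSchrodinger F (n₁ + n₂) (UnitaryGroup.finSum n₁ n₂ T₁ T₂) v)) s
set_option quotPrecheck false in
/-- the centre embedding into `U(J)(F_v)`. -/
local notation "cZ" => UnitaryGroup.localCenter E c (n₁ + n₂) J J' hJ' v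
set_option quotPrecheck false in
/-- the centre embedding into `U(J₁)(F_v)`. -/
local notation "c₁" => UnitaryGroup.localCenter E c n₁ J₁ J' hJ' v
set_option quotPrecheck false in
/-- the centre embedding into `U(J₂)(F_v)`. -/
local notation "c₂" => UnitaryGroup.localCenter E c n₂ J₂ J' hJ' v

/-! ## §1 The shear automorphism of `U(J₁)(F_v) × Z` and the pair representation -/

omit [Algebra.IsQuadraticExtension F E] in
/-- **the shear** `(u, z) ↦ (u · (z·1_{n₁}), z)` of `U(J₁)(F_v) × Z` (an automorphism: `z·1_{n₁}` is central).
[cite: Kudla1984, §1] -/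
def centreShear : (G₁ × Zc) ≃* (G₁ × Zc) where
  toFun p := (p.1 * c₁ p.2, p.2)
  invFun p := (p.1 * (c₁ p.2)⁻¹, p.2)
  left_inv p := by simp only [mul_inv_cancel_right]
  right_inv p := by simp only [inv_mul_cancel_right]
  map_mul' p q := by
    refine Prod.ext ?_ rfl
    change (p.1 * q.1) * c₁ (p.2 * q.2) = (p.1 * c₁ p.2) * (q.1 * c₁ q.2)
    rw [map_mul, mul_assoc, mul_assoc, ← mul_assoc q.1, UnitaryGroup.localCenter_comm E c n₁ J₁ J' hJ' v p.2 q.1,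
      mul_assoc]

omit [Algebra.IsQuadraticExtension F E] in
/-- formula. [cite: Kudla1984, §1] -/
@[simp] theorem centreShear_apply (p : G₁ × Zc) : centreShear F E c v n₁ hJ' p = (p.1 * c₁ p.2, p.2) := rfl

omit [Algebra.IsQuadraticExtension F E] in
/-- `ω_s(u ⊕ 1)` commutes with `ω_s` of the centre. [cite: Kudla1984, §1] -/
theorem commute_inlLoc_localCenter (u : G₁) (z : Zc) :
    Commute (((ω).comp (inlLoc F E c v n₁ n₂ hJ₁ hJ)) u) (((ω).comp cZ) z) :=
  (show Commute (inlLoc F E c v n₁ n₂ hJ₁ hJ u) (cZ z) from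
    UnitaryGroup.localCenter_comm E c (n₁ + n₂) J J' hJ' v z _).map ω

omit [Algebra.IsQuadraticExtension F E] in
/-- `ω_s(u ⊕ 1)` commutes with `ω_s(1 ⊕ z·1_{n₂})`. [cite: Kudla1984, §1] -/
theorem commute_inlLoc_inrLoc_localCenter (u : G₁) (z : Zc) :
    Commute (((ω).comp (inlLoc F E c v n₁ n₂ hJ₁ hJ)) u) (((ω).comp ((inrLoc F E c v n₁ n₂ hJ₂ hJ).comp c₂)) z) :=
  (show Commute (inlLoc F E c v n₁ n₂ hJ₁ hJ u) (inrLoc F E c v n₁ n₂ hJ₂ hJ (c₂ z)) from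
    inlLoc_mul_inrLoc_comm F E c v n₁ n₂ hJ₁ hJ₂ hJ u (c₂ z)).map ω

omit [Algebra.IsQuadraticExtension F E] in
-- large block-currency terms: about 2× the default budget
set_option maxHeartbeats 400000 in
/-- **the pair representation `(u, z) ↦ ω_s(u ⊕ 1) ω_s(z·1)` is the pull-back along the shear of
`(u′, z) ↦ ω_s(u′ ⊕ 1) ω_s(1 ⊕ z·1_{n₂})`** (`z · 1_{n₁+n₂} = (z·1_{n₁} ⊕ 1)(1 ⊕ z·1_{n₂})`). [cite: Kudla1984, §1] -/
theorem pairRep_eq_comp_centreShear :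
    pairRep ((ω).comp (inlLoc F E c v n₁ n₂ hJ₁ hJ)) ((ω).comp cZ) (commute_inlLoc_localCenter F E c v n₁ n₂ hJ₁ hJ s hJ') =
      (pairRep ((ω).comp (inlLoc F E c v n₁ n₂ hJ₁ hJ)) ((ω).comp ((inrLoc F E c v n₁ n₂ hJ₂ hJ).comp c₂))
        (commute_inlLoc_inrLoc_localCenter F E c v n₁ n₂ hJ₁ hJ₂ hJ s hJ')).comp
        (centreShear F E c v n₁ hJ').toMonoidHom := by
  refine MonoidHom.ext fun p => LinearMap.ext fun f => ?_
  have hz := localCenter_eq_inlLoc_mul_inrLoc F E c v n₁ n₂ hJ₁ hJ₂ hJ hJ' p.2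
  have hz' : s (cZ p.2) = s (inlLoc F E c v n₁ n₂ hJ₁ hJ (c₁ p.2)) * s (inrLoc F E c v n₁ n₂ hJ₂ hJ (c₂ p.2)) := by
    rw [hz]; exact s.map_mul _ _
  simp only [MonoidHom.comp_apply, MulEquiv.coe_toMonoidHom, centreShear_apply, pairRep_apply, hz', map_mul,
    Module.End.mul_apply]

omit [Algebra.IsQuadraticExtension F E] in
/-- the character side of the shear: `(ξ ⊠ χ) = (ξ ⊠ χ·(ξ∘c₁)⁻¹) ∘ shear`. [cite: Kudla1984, §1] -/
theorem boxChar_eq_comp_centreShear (ξ : G₁ →* ℂˣ) (χ : Zc →* ℂˣ) :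
    boxChar ξ χ = (boxChar ξ (χ * (ξ.comp c₁)⁻¹)).comp (centreShear F E c v n₁ hJ').toMonoidHom := by
  refine MonoidHom.ext fun p => ?_
  rw [MonoidHom.comp_apply, MulEquiv.coe_toMonoidHom, centreShear_apply, boxChar_apply, boxChar_apply, map_mul,
    MonoidHom.mul_apply, MonoidHom.inv_apply, MonoidHom.comp_apply]
  dsimp only
  rw [mul_assoc, mul_comm (ξ (c₁ p.2)), inv_mul_cancel_right]

omit [Algebra.IsQuadraticExtension F E] in
/-- restricting the coinvariant representation to the first block IS the coinvariant representation of the restricted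
action (definitional bookkeeping). [cite: Kudla1984, §1] -/
theorem rep_comp_inlLoc_eq (χ : Zc →* ℂˣ) :
    (rep (ρW := (ω).comp cZ) χ ω (fun g z => (show Commute g (cZ z) from
        UnitaryGroup.localCenter_comm E c (n₁ + n₂) J J' hJ' v z g).map ω)).comp (inlLoc F E c v n₁ n₂ hJ₁ hJ) =
      rep (ρW := (ω).comp cZ) χ ((ω).comp (inlLoc F E c v n₁ n₂ hJ₁ hJ))
        (commute_inlLoc_localCenter F E c v n₁ n₂ hJ₁ hJ s hJ') :=
  MonoidHom.ext fun _ => ext_mk _ _ fun _ => rfl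

/-! ## §2 `Coinv_ξ(Θ_s(χ)|U(J₁)) ≃ Coinv_ξ(ω_{s₁}) ⊗ Θ^{V₂}_{s₂}(χ·(ξ∘c₁)⁻¹)` -/

set_option quotPrecheck false in
/-- `ω_{s₁}` = the oscillator representation of the first block along `restrictLeft s`. -/
local notation "ω₁" => MonoidHom.comp (MpPsi.toRep (localSchrodinger F n₁ T₁ v))
  (restrictLeft F E c v n₁ n₂ hJ₁ hJ hcδ hδ hd hT₁ hT₂ hT₂d s hs)
set_option quotPrecheck false in
/-- `ω_{s₂}` = the oscillator representation of the second block along `restrictRight s`. -/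
local notation "ω₂" => MonoidHom.comp (MpPsi.toRep (localSchrodinger F n₂ T₂ v))
  (restrictRight F E c v n₁ n₂ hJ₂ hJ hcδ hδ hd hT₁ hT₂ hT₁d s hs)

omit [Algebra.IsQuadraticExtension F E] in
/-- step (0): the relation submodules of `Θ_s(χ)|U(J₁)` and of `rep` of the restricted action coincide.
[cite: Kudla1984, §1] -/
theorem ker_rep_comp_inlLoc_eq (ξ : G₁ →* ℂˣ) (χ : Zc →* ℂˣ) :
    ker ((rep (ρW := (ω).comp cZ) χ ω (fun g z => (show Commute g (cZ z) from
        UnitaryGroup.localCenter_comm E c (n₁ + n₂) J J' hJ' v z g).map ω)).comp (inlLoc F E c v n₁ n₂ hJ₁ hJ)) ξ =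
      ker (rep (ρW := (ω).comp cZ) χ ((ω).comp (inlLoc F E c v n₁ n₂ hJ₁ hJ))
        (commute_inlLoc_localCenter F E c v n₁ n₂ hJ₁ hJ s hJ')) ξ :=
  congrArg (fun ρ => ker ρ ξ) (rep_comp_inlLoc_eq F E c v n₁ n₂ hJ₁ hJ s hJ' χ)

omit [Algebra.IsQuadraticExtension F E] in
/-- step (2): the relation submodules before and after the shear coincide. [cite: Kudla1984, §1] -/
theorem ker_pairRep_eq (ξ : G₁ →* ℂˣ) (χ : Zc →* ℂˣ) :
    ker (pairRep ((ω).comp (inlLoc F E c v n₁ n₂ hJ₁ hJ)) ((ω).comp cZ)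
        (commute_inlLoc_localCenter F E c v n₁ n₂ hJ₁ hJ s hJ')) (boxChar ξ χ) =
      ker (pairRep ((ω).comp (inlLoc F E c v n₁ n₂ hJ₁ hJ)) ((ω).comp ((inrLoc F E c v n₁ n₂ hJ₂ hJ).comp c₂))
        (commute_inlLoc_inrLoc_localCenter F E c v n₁ n₂ hJ₁ hJ₂ hJ s hJ')) (boxChar ξ (χ * (ξ.comp c₁)⁻¹)) := by
  rw [pairRep_eq_comp_centreShear F E c v n₁ n₂ hJ₁ hJ₂ hJ s hJ', boxChar_eq_comp_centreShear F E c v n₁ hJ' ξ χ,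
    ker_comp_mulEquiv]

-- large block-currency terms: about 2× the default budget
set_option maxHeartbeats 400000 in
/-- step (3): **transport along `𝒮(F_v^{n₁}) ⊗ 𝒮(F_v^{n₂}) ≃ 𝒮(F_v^{n₁+n₂})`** — the pair representation
`(u′, z) ↦ ω_s((u′ ⊕ 1)(1 ⊕ z·1_{n₂}))` corresponds to the outer tensor product `ω_{s₁} ⊠ (ω_{s₂} ∘ c₂)` of the block
restrictions. [cite: MoeglinVignerasWaldspurger1987, Chap. 2 II.1 Rem. (6)] -/
theorem sumEquivSB_boxRep (p : G₁ × Zc) (x : SchwartzBruhat (Fin n₁ → Fv) ⊗[ℂ] SchwartzBruhat (Fin n₂ → Fv)) :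
    sumEquivSB Fv eS (boxRep ω₁ ((ω₂).comp c₂) p x) =
      pairRep ((ω).comp (inlLoc F E c v n₁ n₂ hJ₁ hJ)) ((ω).comp ((inrLoc F E c v n₁ n₂ hJ₂ hJ).comp c₂))
        (commute_inlLoc_inrLoc_localCenter F E c v n₁ n₂ hJ₁ hJ₂ hJ s hJ') p (sumEquivSB Fv eS x) := by
  induction x using TensorProduct.induction_on with
  | zero => simp only [map_zero]
  | tmul f₁ f₂ =>
      simp only [boxRep_apply_tmul, sumEquivSB_tmul, pairRep_apply, MonoidHom.comp_apply,
        toRep_inrLoc_boxSB F E c v n₁ n₂ hJ₂ hJ hcδ hδ hd hT₁ hT₂ hT₁d s hs,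
        toRep_inlLoc_boxSB F E c v n₁ n₂ hJ₁ hJ hcδ hδ hd hT₁ hT₂ hT₂d s hs]
  | add x y hx hy => simp only [map_add, hx, hy]

-- large block-currency terms: about 2× the default budget
set_option maxHeartbeats 400000 in
/-- step (3) in the shape of `TwistedCoinv.mapEquiv` (transport along `sumEquivSB.symm`, scalar `1`).
[cite: MoeglinVignerasWaldspurger1987, Chap. 2 II.1 Rem. (6)] -/
theorem boxRep_sumEquivSB_symm (p : G₁ × Zc) (f : SchwartzBruhat (Fin (n₁ + n₂) → Fv)) :
    boxRep ω₁ ((ω₂).comp c₂) p ((sumEquivSB Fv eS).symm f) =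
      (((1 : G₁ × Zc → ℂˣ) p : ℂˣ) : ℂ) • (sumEquivSB Fv eS).symm
        (pairRep ((ω).comp (inlLoc F E c v n₁ n₂ hJ₁ hJ)) ((ω).comp ((inrLoc F E c v n₁ n₂ hJ₂ hJ).comp c₂))
          (commute_inlLoc_inrLoc_localCenter F E c v n₁ n₂ hJ₁ hJ₂ hJ s hJ') p f) := by
  have h1 : (((1 : G₁ × Zc → ℂˣ) p : ℂˣ) : ℂ) = 1 := rfl
  rw [h1, one_smul]
  apply (sumEquivSB Fv eS).injective
  simp only [sumEquivSB_boxRep F E c hcδ hδ hd v n₁ n₂ hT₁ hT₂ hT₁d hT₂d hJ₁ hJ₂ hJ s hs hJ', LinearEquiv.apply_symm_apply]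

-- twenty-binder block currency; the chained equivalence elaborates at about 2× the default budget
set_option maxHeartbeats 400000 in
/-- **`Coinv_ξ(Θ_s(χ)|U(J₁)) ≃ Coinv_ξ(ω_{s₁}) ⊗ Θ^{V₂}_{s₂}(χ · (ξ ∘ c₁)⁻¹)`**: the `ξ`-coinvariants under the first
block of the `χ`-coinvariant representation are the tensor product of the `ξ`-coinvariants of the small oscillator
representation `ω_{s₁}` with the rank-one theta lift, for the second block, of the shifted centre character
(iterated coinvariants → shear → transport along `sumEquivSB` → coinvariants of an outer tensor product).
[cite: MoeglinVignerasWaldspurger1987, Chap. 2 II.1 Rem. (6)] -/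
def coinvLineEquiv (ξ : G₁ →* ℂˣ) (χ : Zc →* ℂˣ) :
    Coinv ((rep (ρW := (ω).comp cZ) χ ω (fun g z => (show Commute g (cZ z) from
        UnitaryGroup.localCenter_comm E c (n₁ + n₂) J J' hJ' v z g).map ω)).comp (inlLoc F E c v n₁ n₂ hJ₁ hJ)) ξ ≃ₗ[ℂ]
      Coinv ω₁ ξ ⊗[ℂ] Coinv ((ω₂).comp c₂) (χ * (ξ.comp c₁)⁻¹) :=
  (Submodule.quotEquivOfEq _ _ (ker_rep_comp_inlLoc_eq F E c v n₁ n₂ hJ₁ hJ s hJ' ξ χ)).trans <|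
  (coinvCoinvEquiv ((ω).comp (inlLoc F E c v n₁ n₂ hJ₁ hJ)) ((ω).comp cZ)
      (commute_inlLoc_localCenter F E c v n₁ n₂ hJ₁ hJ s hJ') ξ χ).trans <|
  (Submodule.quotEquivOfEq _ _ (ker_pairRep_eq F E c v n₁ n₂ hJ₁ hJ₂ hJ s hJ' ξ χ)).trans <|
  (mapEquiv
      (pairRep ((ω).comp (inlLoc F E c v n₁ n₂ hJ₁ hJ)) ((ω).comp ((inrLoc F E c v n₁ n₂ hJ₂ hJ).comp c₂))
        (commute_inlLoc_inrLoc_localCenter F E c v n₁ n₂ hJ₁ hJ₂ hJ s hJ'))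
      (boxChar ξ (χ * (ξ.comp c₁)⁻¹)) (boxRep ω₁ ((ω₂).comp c₂)) (boxChar ξ (χ * (ξ.comp c₁)⁻¹))
      (sumEquivSB Fv eS).symm 1
      (boxRep_sumEquivSB_symm F E c hcδ hδ hd v n₁ n₂ hT₁ hT₂ hT₁d hT₂d hJ₁ hJ₂ hJ s hs hJ')
      (fun h => by rw [Pi.one_apply, one_mul])).trans <|
  coinvTensorEquiv ω₁ ((ω₂).comp c₂) ξ (χ * (ξ.comp c₁)⁻¹)

/-! ## §3 The type set of `Θ_s(χ)|_{U(J₁)}` is that of `ω_{s₁}` when `(E_v^{n₂}, J₂)` is isotropic -/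

omit [Algebra.IsQuadraticExtension F E] in
/-- the shifted centre character `χ · (ξ ∘ c₁)⁻¹` is unitary if `χ` and `ξ` are. [cite: Kudla1984, §1] -/
theorem norm_mul_inv_comp_localCenter (χ : Zc →* ℂˣ) (hχu : ∀ z, ‖((χ z : ℂˣ) : ℂ)‖ = 1) (ξ : G₁ →* ℂˣ)
    (hξu : ∀ u, ‖((ξ u : ℂˣ) : ℂ)‖ = 1) (z : Zc) : ‖(((χ * (ξ.comp c₁)⁻¹) z : ℂˣ) : ℂ)‖ = 1 := by
  rw [MonoidHom.mul_apply, MonoidHom.inv_apply, MonoidHom.comp_apply, Units.val_mul, norm_mul, hχu,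
    Units.val_inv_eq_inv_val, norm_inv, hξu, inv_one, mul_one]

omit [Algebra.IsQuadraticExtension F E] in
/-- the shifted centre character `χ · (ξ ∘ c₁)⁻¹` is continuous if `χ` and `ξ` are. [cite: Kudla1984, §1] -/
theorem continuous_mul_inv_comp_localCenter (χ : Zc →* ℂˣ) (hχc : Continuous fun z => ((χ z : ℂˣ) : ℂ))
    (ξ : G₁ →* ℂˣ) (hξc : Continuous fun u => ((ξ u : ℂˣ) : ℂ)) :
    Continuous fun z => (((χ * (ξ.comp c₁)⁻¹) z : ℂˣ) : ℂ) := by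
  have h1 : Continuous fun z : Zc => ((ξ (c₁ z) : ℂˣ) : ℂ) :=
    hξc.comp (UnitaryGroup.continuous_localCenter E c n₁ J₁ J' hJ' v)
  have h2 : Continuous fun z : Zc => (((ξ (c₁ z) : ℂˣ) : ℂ))⁻¹ := h1.inv₀ fun z => Units.ne_zero _
  have h3 : (fun z : Zc => (((χ * (ξ.comp c₁)⁻¹) z : ℂˣ) : ℂ)) =
      fun z => ((χ z : ℂˣ) : ℂ) * (((ξ (c₁ z) : ℂˣ) : ℂ))⁻¹ := by
    funext z
    rw [MonoidHom.mul_apply, MonoidHom.inv_apply, MonoidHom.comp_apply, Units.val_mul, Units.val_inv_eq_inv_val]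
  rw [h3]
  exact hχc.mul h2

include hJ₂ hT₁d in
-- twenty-binder block currency plus the IV-2 instantiation; about 2× the default budget
set_option maxHeartbeats 400000 in
/-- **THE `U(J₁)`-TYPES OF `Θ_s(χ)` ARE THE TYPES OF `ω_{s₁}`** (stable range for the second block): if `E ⊗_F F_v` is a
field, `2 ≤ n₂`, `(E_v^{n₂}, J₂)` is isotropic and `ω_s` is smooth, then for every unitary continuous `χ` of the centre
and every unitary continuous `ξ` of `U(J₁)(F_v)`, the `ξ`-coinvariants of `Θ_s(χ)|_{U(J₁)}` are non-zero iff the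
`ξ`-coinvariants of `ω_{s₁}` are (the second tensor factor of `coinvLineEquiv` is non-zero by IV-2
`mvw_IV2_rankOne_nonvanishing_of_isotropic_holds` at the unitary continuous character `χ·(ξ∘c₁)⁻¹`).
[cite: MoeglinVignerasWaldspurger1987, Chap. 3 IV.2 Lemme (stable range) and Chap. 2 II.1 Rem. (6)] -/
theorem nontrivial_coinv_line_iff (hE : IsField (UnitaryGroup.LocalRing E v))
    (hsm : Representation.IsSmooth ((MpPsi.toRep (localSchrodinger F (n₁ + n₂) (UnitaryGroup.finSum n₁ n₂ T₁ T₂) v)).comp s))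
    (hn₂ : 2 ≤ n₂) (hJ₂h : (J₂.map c)ᵀ = J₂) (hJ₂det : J₂.det ≠ 0)
    (hiso : LemD1.IsIsotropic (LemD1OfPlace.standingData E v c n₂ J₂ hcδ hδ hn₂ hJ₂h hJ₂det))
    (χ : Zc →* ℂˣ) (hχu : ∀ z, ‖((χ z : ℂˣ) : ℂ)‖ = 1) (hχc : Continuous fun z => ((χ z : ℂˣ) : ℂ))
    (ξ : G₁ →* ℂˣ) (hξu : ∀ u, ‖((ξ u : ℂˣ) : ℂ)‖ = 1) (hξc : Continuous fun u => ((ξ u : ℂˣ) : ℂ)) :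
    Nontrivial (Coinv ((rep (ρW := (ω).comp cZ) χ ω (fun g z => (show Commute g (cZ z) from
        UnitaryGroup.localCenter_comm E c (n₁ + n₂) J J' hJ' v z g).map ω)).comp (inlLoc F E c v n₁ n₂ hJ₁ hJ)) ξ) ↔
      Nontrivial (Coinv ω₁ ξ) := by
  -- IV-2 for the second block: the theta lift of `χ·(ξ∘c₁)⁻¹` along `restrictRight s` is non-zero
  have hΘ : Nontrivial (Coinv ((ω₂).comp c₂) (χ * (ξ.comp c₁)⁻¹)) :=
    mvw_IV2_rankOne_nonvanishing_of_isotropic_holds F E c n₂ δ hcδ hδ d hd T₂ hT₂ hT₂d J₂ hJ₂ v hE hn₂ hJ₂h hJ₂det hiso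
      (restrictRight F E c v n₁ n₂ hJ₂ hJ hcδ hδ hd hT₁ hT₂ hT₁d s hs)
      (proj_restrictRight F E c v n₁ n₂ hJ₂ hJ hcδ hδ hd hT₁ hT₂ hT₁d s hs)
      (isSmooth_restrictRight F E c v n₁ n₂ hJ₂ hJ hcδ hδ hd hT₁ hT₂ hT₁d s hs hsm) J' hJ' (χ * (ξ.comp c₁)⁻¹)
      (norm_mul_inv_comp_localCenter F E c v n₁ hJ' χ hχu ξ hξu)
      (continuous_mul_inv_comp_localCenter F E c v n₁ hJ' χ hχc ξ hξc)
  have e := (coinvLineEquiv F E c hcδ hδ hd v n₁ n₂ hT₁ hT₂ hT₁d hT₂d hJ₁ hJ₂ hJ s hs hJ' ξ χ).toEquiv.nontrivial_congr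
  exact ⟨fun h => (nontrivial_tensor_iff.1 (e.1 h)).1, fun h => e.2 (nontrivial_tensor_iff.2 ⟨h, hΘ⟩)⟩

end Literature.RepresentationTheory.MoeglinVignerasWaldspurger1987

end
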